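import Summits.BirchSwinnertonDyer.BirchSwinnertonDyer.Theorems.KimAtThreeDeepLowerNonAdditiveRows
import Summits.BirchSwinnertonDyer.Rank1Residual.Additive.AdditiveOrdinaryLowerHalf
import Literature.NumberTheory.EllipticCurves.Rank1Residual.GVParityTwistTransportProofs
import Literature.NumberTheory.EllipticCurves.IsogenyDualInseparableProofs
import HarnessLib

/-!
# Route `KimAtThreeKolyvagin` (rung W2), crux `DeepLowerAtThree` (item 19075) on the ORDINARY-TYPE
# additive rows FROM THE SISTER ROUTE K1 (`AdditiveBranchIMC`, leaf `AdditiveOrdinaryLowerHalf`)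

Cell `bsd-addord`, seat `bsd-addord-w2-c2` (D-0074 row B5, gen 2), item `stmt-BirchSwinnertonDyer-19075`.
Sequel of `KimAtThreeDeepLowerSmallDefect` (p426576, this seat): there, on every tower row of analytic
rank `0` carrying the `3`-adic period transfer `Ω(W) = u · Ω⁺_f`, crux 19075's conclusion
`∃ d, ∂^{(∞)}_{deep}(δ̃) = d ∧ ∂⁽⁰⁾(δ̃) ≤ ord₃ #Ш(E/ℚ)(3) + d` was shown to FOLLOW from Miller's lower half
`Typed.MissingLowerBoundAt W 3` (`ord₃ #Ш_an ≤ ord₃ #Ш`) together with «Tamagawa divisibility of deep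
Kurihara numbers» `v₃(∏ c_ℓ) ≤ ∂^{(∞)}_{deep}(δ̃)` — and from the lower half ALONE when `3 ∤ ∏ c_ℓ`.

The cell's OTHER route K1 = `route-BirchSwinnertonDyer-AdditiveBranchIMC` has as its leaf exactly that
lower half on the ordinary-type additive locus: `AdditiveOrdinaryLowerHalf :
∀ W p, r_an ≤ 1 → N10.Locus W p → MissingLowerBoundAt W p` with `N10.Locus W p = (p ≠ 2 ∧ Addv W p ∧
(PotMult W p ∨ TypeGOrd W p))` — and `p = 3` IS in its scope (cells (M)@3 and (G-ord, `e = 2`)@3; the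
cell (G-ord, `e ∈ {3,4,6}`) is empty at `3`, `N10.five_le_of_cellGordHigher`). Its rank-`0` part is the
cell statement `N10.LowerHalf`, and its (M)-rows item is K1's crux `MultLower` (item 19359), whose BODY
is `∀ W p, r_an ≤ 1 → N10.CellM W p → MissingLowerBoundAt W p`. Hence (this file; theorems only,
the K1 statements enter as hypotheses BY NAME or BY SHAPE, nothing asserted, nothing booked, both routes'
items stay open):

* `deepLowerAtThree_row_of_n10LowerHalf_of_tamagawa_le_deepInfty`: `N10.LowerHalf` ∧ GZK ⟹ crux 19075's
  conclusion on every row of the crux lying on `N10.Locus W 3` with the period transfer and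
  `v₃(∏ c_ℓ) ≤ ∂^{(∞)}_{deep}`; `…_of_not_three_dvd_tamagawa`: the same with `3 ∤ ∏ c_ℓ` in place of the
  divisibility — NO Euler-system input of route W2 at all on those rows;
* `deepLowerAtThree_row_of_additiveOrdinaryLowerHalf_…`: the same two from K1's LEAF;
* `deepLowerAtThree_row_cellM_of_multLower_…`: the same two on the (M)@3 rows (B3's 82 103-pair
  sub-block) from the BODY of K1's crux `MultLower` (stated inline, token for token; this file does not
  import the K1 route file, so the item can be fed by `fun h => h` from `Theses.AdditiveBranchIMC.MultLower`).

* `deepLowerAtThree_row_cellGordTwo_of_gordTwoOffCaseOne[Odd]_…`: the same two on the (G-ord, `e = 2`)@3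
  rows from the BODY of K1's crux `GordTwoRankZeroOffCaseOne` (item 19357) or of its odd-parity half
  `…Odd` (item 19245; `p = 3` is odd) — a tower row has no Case-1 member (`not_hasCaseOneMember_of_irr`:
  a Case-1 member is an isogenous curve with REDUCIBLE `E′[3]`, and reducibility is an isogeny invariant).
  (The socket from Miller's `BSDp W 3` at ANY tower row is `KimAtThreeDeepLowerNonAdditiveRows` §1.)

So: when K1 closes (or its (M) crux alone), the deciding crux of W2 closes OUTRIGHT on the N10@3 (resp.
(M)@3) tower rows with `3 ∤ ∏ c_ℓ` and unit period transfer, and on all N10@3 rows it is reduced to the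
single inequality `v₃(∏ c_ℓ) ≤ ∂^{(∞)}_{deep}(δ̃)` (Kim 2022 Conj. 1.10, `≥` half, deep reading). The
complementary N11 rows (potentially SUPERSINGULAR / wild `3`: cells O5/O6) are not touched by K1.

References: [Kim2022StructureSelmer] §1.5.1 (PDF p. 7), Conj. 1.10 (PDF p. 8), Thm. 1.9 (6);
[Kim2025RefinedTNC] Thm. 1.1; [Delbourgo1998] Main Conjecture (p. 151); [Miller2011LMS] Def. 1.1.
-/

set_option autoImplicit false
-- the Theorems namespace of a single-conjunct summit repeats the summit name by design (D-0017)
set_option linter.dupNamespace false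

noncomputable section

open scoped MatrixGroups ModularForm Classical

open CongruenceSubgroup WeierstrassCurve Literature.NumberTheory.EllipticCurves
  Literature.NumberTheory.EllipticCurves.ModularForms
  Literature.NumberTheory.EllipticCurves.Rank1Residual
  Literature.NumberTheory.EllipticCurves.Rank1Residual.Typed

namespace Summit.BirchSwinnertonDyer.BirchSwinnertonDyer.Theorems.KimAtThreeDeepLowerOfAdditiveBranch

open Summit.BirchSwinnertonDyer.Rank1Residual.Additive
open Summit.BirchSwinnertonDyer.BirchSwinnertonDyer.Theses.KimAtThreeKolyvagin
open Summit.BirchSwinnertonDyer.BirchSwinnertonDyer.Theorems.KimAtThreeKolyvaginUnitLevelOneRungs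
open Summit.BirchSwinnertonDyer.BirchSwinnertonDyer.Theorems.KimAtThreeDeepLowerSmallDefect
open Summit.BirchSwinnertonDyer.BirchSwinnertonDyer.Theorems.KimAtThreeDeepLowerNonAdditiveRows

/-! ### §1 One row: from a lower-half statement on a locus containing the row -/

section Row

variable (W : WeierstrassCurve ℚ) [W.IsElliptic] [W.IsGloballyMinimal]
  {N : ℕ} [NeZero N] (f : CuspForm (Gamma0 N) 2)

/-- **Core step.** If SOME statement `L` yields `MissingLowerBoundAt W 3` at the row (here: any of the K1
statements, applied at `p = 3`), then on a tower row of analytic rank `0` with the `3`-adic period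
transfer, «Tamagawa divisibility» `v₃(∏ c_ℓ) ≤ ∂^{(∞)}_{deep}(δ̃)` gives crux 19075's conclusion (p426576's
`deepLower_conclusion_of_missingLowerBoundAt_of_tamagawa_le_deepInfty`, `E[3]` irreducible from the
tower). [cite: Kim2022StructureSelmer, Conj. 1.10 (PDF p. 8), Thm. 1.9 (6)] [cite: Miller2011LMS, Def. 1.1] -/
theorem deepLower_conclusion_three_of_missingLowerBoundAt_of_tamagawa_le_deepInfty
    (hGZK : rank_eq_analyticRank_of_analyticRank_le_one)
    (htower : ∀ n : ℕ, W.HasSurjectiveModNGaloisRep (3 ^ n : ℕ)) (hf : IsNewformOf W f)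
    (hord : kuriharaVanishingOrder W 3 f = 0)
    (hper : ∃ u : ℚ, ‖(u : ℚ_[3])‖ = 1 ∧ W.realPeriodRat = u * plusPeriod f)
    (hlow : MissingLowerBoundAt W 3)
    (htam : ((padicValNat 3 W.tamagawaProduct : ℕ) : ℕ∞) ≤ kuriharaPartialDeepInfty W 3 f) :
    ∃ d : ℕ, kuriharaPartialDeepInfty W 3 f = d ∧
      kuriharaPartial W 3 f 0 ≤
        ((padicValNat 3 (Nat.card (AddCommGroup.primaryComponent W.sha 3)) + d : ℕ) : ℕ∞) := by
  haveI : Fact (Nat.Prime 3) := ⟨Nat.prime_three⟩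
  exact deepLower_conclusion_of_missingLowerBoundAt_of_tamagawa_le_deepInfty W 3 f hGZK (by norm_num)
    (hasIrreducibleModPGaloisRep_of_hasSurjectiveModNGaloisRep W 3 (by simpa using htower 1))
    hf hord hper hlow htam

end Row

/-! ### §2 From the cell statement `N10.LowerHalf` (rank-`0` part of K1's leaf) -/

/-- **`N10.LowerHalf` ∧ GZK ⟹ crux 19075 on its N10@3 rows, modulo Tamagawa divisibility.** Crux binders
verbatim, then: the row lies on `N10.Locus W 3` (additive `3`, potentially multiplicative or (G)-ordinary),
the `3`-adic period transfer, and `v₃(∏ c_ℓ) ≤ ∂^{(∞)}_{deep}(δ̃)`. [cite: Delbourgo1998, Main Conjecture (p. 151)]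
[cite: Kim2022StructureSelmer, Conj. 1.10 (PDF p. 8)] -/
theorem deepLowerAtThree_row_of_n10LowerHalf_of_tamagawa_le_deepInfty
    (hN10 : N10.LowerHalf) (hGZK : rank_eq_analyticRank_of_analyticRank_le_one) :
    ∀ (W : WeierstrassCurve ℚ) [W.IsElliptic] [W.IsGloballyMinimal],
      (∀ n : ℕ, W.HasSurjectiveModNGaloisRep (3 ^ n : ℕ)) →
      Finite W.sha →
      ∀ {N : ℕ} [NeZero N] (f : CuspForm (Gamma0 N) 2), IsNewformOf W f →
      (∀ r : ℚ, ratPlusSymbol f r ≠ 0 → 0 ≤ padicValRat 3 (ratPlusSymbol f r)) →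
      kuriharaVanishingOrder W 3 f = 0 →
      (haveI : Fact (Nat.Prime 3) := ⟨Nat.prime_three⟩; N10.Locus W 3) →
      (∃ u : ℚ, ‖(u : ℚ_[3])‖ = 1 ∧ W.realPeriodRat = u * plusPeriod f) →
      ((padicValNat 3 W.tamagawaProduct : ℕ) : ℕ∞) ≤ kuriharaPartialDeepInfty W 3 f →
        ∃ d : ℕ, kuriharaPartialDeepInfty W 3 f = d ∧
          kuriharaPartial W 3 f 0 ≤
            ((padicValNat 3 (Nat.card (AddCommGroup.primaryComponent W.sha 3)) + d : ℕ) : ℕ∞) := by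
  intro W _ _ htower _ N _ f hf _ hord hloc hper htam
  haveI : Fact (Nat.Prime 3) := ⟨Nat.prime_three⟩
  exact deepLower_conclusion_three_of_missingLowerBoundAt_of_tamagawa_le_deepInfty W f hGZK htower hf
    hord hper (hN10 W 3 (analyticRank_eq_zero_of_kuriharaVanishingOrder_eq_zero W f hf hord) hloc) htam

/-- **`N10.LowerHalf` ∧ GZK ⟹ crux 19075 OUTRIGHT on its N10@3 rows with `3 ∤ ∏ c_ℓ`** (unit period
transfer). [cite: Delbourgo1998, Main Conjecture (p. 151)] [cite: Kim2022StructureSelmer, Thm. 1.9 (6)] -/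
theorem deepLowerAtThree_row_of_n10LowerHalf_of_not_three_dvd_tamagawa
    (hN10 : N10.LowerHalf) (hGZK : rank_eq_analyticRank_of_analyticRank_le_one) :
    ∀ (W : WeierstrassCurve ℚ) [W.IsElliptic] [W.IsGloballyMinimal],
      (∀ n : ℕ, W.HasSurjectiveModNGaloisRep (3 ^ n : ℕ)) →
      Finite W.sha →
      ∀ {N : ℕ} [NeZero N] (f : CuspForm (Gamma0 N) 2), IsNewformOf W f →
      (∀ r : ℚ, ratPlusSymbol f r ≠ 0 → 0 ≤ padicValRat 3 (ratPlusSymbol f r)) →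
      kuriharaVanishingOrder W 3 f = 0 →
      (haveI : Fact (Nat.Prime 3) := ⟨Nat.prime_three⟩; N10.Locus W 3) →
      (∃ u : ℚ, ‖(u : ℚ_[3])‖ = 1 ∧ W.realPeriodRat = u * plusPeriod f) →
      ¬ 3 ∣ W.tamagawaProduct →
        ∃ d : ℕ, kuriharaPartialDeepInfty W 3 f = d ∧
          kuriharaPartial W 3 f 0 ≤
            ((padicValNat 3 (Nat.card (AddCommGroup.primaryComponent W.sha 3)) + d : ℕ) : ℕ∞) := by
  intro W _ _ htower hfin N _ f hf hint hord hloc hper htam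
  haveI : Fact (Nat.Prime 3) := ⟨Nat.prime_three⟩
  refine deepLowerAtThree_row_of_n10LowerHalf_of_tamagawa_le_deepInfty hN10 hGZK W htower hfin f hf hint
    hord hloc hper ?_
  rw [padicValNat.eq_zero_of_not_dvd htam, Nat.cast_zero]
  exact zero_le

/-! ### §3 From K1's LEAF `AdditiveOrdinaryLowerHalf` (rung K1 of the ladder) -/

/-- K1's leaf contains the rank-`0` cell statement `N10.LowerHalf` (`additiveOrdinaryLowerHalf_iff`).
[cite: Delbourgo1998, Main Conjecture (p. 151)] -/
theorem n10LowerHalf_of_additiveOrdinaryLowerHalf (h : AdditiveOrdinaryLowerHalf) : N10.LowerHalf :=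
  (additiveOrdinaryLowerHalf_iff.mp h).1

/-- **K1's leaf ∧ GZK ⟹ crux 19075 on the N10@3 rows, modulo Tamagawa divisibility.**
[cite: Delbourgo1998, Main Conjecture (p. 151)] [cite: Kim2022StructureSelmer, Conj. 1.10 (PDF p. 8)] -/
theorem deepLowerAtThree_row_of_additiveOrdinaryLowerHalf_of_tamagawa_le_deepInfty
    (hK1 : AdditiveOrdinaryLowerHalf) (hGZK : rank_eq_analyticRank_of_analyticRank_le_one) :
    ∀ (W : WeierstrassCurve ℚ) [W.IsElliptic] [W.IsGloballyMinimal],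
      (∀ n : ℕ, W.HasSurjectiveModNGaloisRep (3 ^ n : ℕ)) →
      Finite W.sha →
      ∀ {N : ℕ} [NeZero N] (f : CuspForm (Gamma0 N) 2), IsNewformOf W f →
      (∀ r : ℚ, ratPlusSymbol f r ≠ 0 → 0 ≤ padicValRat 3 (ratPlusSymbol f r)) →
      kuriharaVanishingOrder W 3 f = 0 →
      (haveI : Fact (Nat.Prime 3) := ⟨Nat.prime_three⟩; N10.Locus W 3) →
      (∃ u : ℚ, ‖(u : ℚ_[3])‖ = 1 ∧ W.realPeriodRat = u * plusPeriod f) →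
      ((padicValNat 3 W.tamagawaProduct : ℕ) : ℕ∞) ≤ kuriharaPartialDeepInfty W 3 f →
        ∃ d : ℕ, kuriharaPartialDeepInfty W 3 f = d ∧
          kuriharaPartial W 3 f 0 ≤
            ((padicValNat 3 (Nat.card (AddCommGroup.primaryComponent W.sha 3)) + d : ℕ) : ℕ∞) :=
  deepLowerAtThree_row_of_n10LowerHalf_of_tamagawa_le_deepInfty
    (n10LowerHalf_of_additiveOrdinaryLowerHalf hK1) hGZK

/-- **K1's leaf ∧ GZK ⟹ crux 19075 OUTRIGHT on the N10@3 rows with `3 ∤ ∏ c_ℓ`** (unit period transfer).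
[cite: Delbourgo1998, Main Conjecture (p. 151)] [cite: Kim2022StructureSelmer, Thm. 1.9 (6)] -/
theorem deepLowerAtThree_row_of_additiveOrdinaryLowerHalf_of_not_three_dvd_tamagawa
    (hK1 : AdditiveOrdinaryLowerHalf) (hGZK : rank_eq_analyticRank_of_analyticRank_le_one) :
    ∀ (W : WeierstrassCurve ℚ) [W.IsElliptic] [W.IsGloballyMinimal],
      (∀ n : ℕ, W.HasSurjectiveModNGaloisRep (3 ^ n : ℕ)) →
      Finite W.sha →
      ∀ {N : ℕ} [NeZero N] (f : CuspForm (Gamma0 N) 2), IsNewformOf W f →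
      (∀ r : ℚ, ratPlusSymbol f r ≠ 0 → 0 ≤ padicValRat 3 (ratPlusSymbol f r)) →
      kuriharaVanishingOrder W 3 f = 0 →
      (haveI : Fact (Nat.Prime 3) := ⟨Nat.prime_three⟩; N10.Locus W 3) →
      (∃ u : ℚ, ‖(u : ℚ_[3])‖ = 1 ∧ W.realPeriodRat = u * plusPeriod f) →
      ¬ 3 ∣ W.tamagawaProduct →
        ∃ d : ℕ, kuriharaPartialDeepInfty W 3 f = d ∧
          kuriharaPartial W 3 f 0 ≤
            ((padicValNat 3 (Nat.card (AddCommGroup.primaryComponent W.sha 3)) + d : ℕ) : ℕ∞) :=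
  deepLowerAtThree_row_of_n10LowerHalf_of_not_three_dvd_tamagawa
    (n10LowerHalf_of_additiveOrdinaryLowerHalf hK1) hGZK

/-! ### §4 From the BODY of K1's crux `MultLower` (item 19359): the (M)@3 rows -/

/-- **K1's crux `MultLower` (stated by shape) ∧ GZK ⟹ crux 19075 on the (M)@3 rows, modulo Tamagawa
divisibility.** The first hypothesis is, token for token, the body of
`Summit.BirchSwinnertonDyer.BirchSwinnertonDyer.Theses.AdditiveBranchIMC.MultLower` (item 19359).
Row: crux binders + `N10.CellM W 3` (additive, potentially multiplicative `3`) + period transfer +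
`v₃(∏ c_ℓ) ≤ ∂^{(∞)}_{deep}(δ̃)`. [cite: Delbourgo1998, Main Conjecture (p. 151), hypothesis (M) (p. 133)]
[cite: Kim2022StructureSelmer, Conj. 1.10 (PDF p. 8)] -/
theorem deepLowerAtThree_row_cellM_of_multLower_of_tamagawa_le_deepInfty
    (hMult : ∀ (W : WeierstrassCurve ℚ) [W.IsElliptic] [W.IsGloballyMinimal] (p : ℕ) [Fact p.Prime],
      W.analyticRank ≤ 1 → N10.CellM W p → MissingLowerBoundAt W p)
    (hGZK : rank_eq_analyticRank_of_analyticRank_le_one) :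
    ∀ (W : WeierstrassCurve ℚ) [W.IsElliptic] [W.IsGloballyMinimal],
      (∀ n : ℕ, W.HasSurjectiveModNGaloisRep (3 ^ n : ℕ)) →
      Finite W.sha →
      ∀ {N : ℕ} [NeZero N] (f : CuspForm (Gamma0 N) 2), IsNewformOf W f →
      (∀ r : ℚ, ratPlusSymbol f r ≠ 0 → 0 ≤ padicValRat 3 (ratPlusSymbol f r)) →
      kuriharaVanishingOrder W 3 f = 0 →
      (haveI : Fact (Nat.Prime 3) := ⟨Nat.prime_three⟩; N10.CellM W 3) →
      (∃ u : ℚ, ‖(u : ℚ_[3])‖ = 1 ∧ W.realPeriodRat = u * plusPeriod f) →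
      ((padicValNat 3 W.tamagawaProduct : ℕ) : ℕ∞) ≤ kuriharaPartialDeepInfty W 3 f →
        ∃ d : ℕ, kuriharaPartialDeepInfty W 3 f = d ∧
          kuriharaPartial W 3 f 0 ≤
            ((padicValNat 3 (Nat.card (AddCommGroup.primaryComponent W.sha 3)) + d : ℕ) : ℕ∞) := by
  intro W _ _ htower _ N _ f hf _ hord hcell hper htam
  haveI : Fact (Nat.Prime 3) := ⟨Nat.prime_three⟩
  have hr0 := analyticRank_eq_zero_of_kuriharaVanishingOrder_eq_zero W f hf hord
  exact deepLower_conclusion_three_of_missingLowerBoundAt_of_tamagawa_le_deepInfty W f hGZK htower hf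
    hord hper (hMult W 3 (by rw [hr0]; exact zero_le_one) hcell) htam

/-- **K1's crux `MultLower` (by shape) ∧ GZK ⟹ crux 19075 OUTRIGHT on the (M)@3 rows with `3 ∤ ∏ c_ℓ`**
(unit period transfer). [cite: Delbourgo1998, Main Conjecture (p. 151), hypothesis (M) (p. 133)]
[cite: Kim2022StructureSelmer, Thm. 1.9 (6)] -/
theorem deepLowerAtThree_row_cellM_of_multLower_of_not_three_dvd_tamagawa
    (hMult : ∀ (W : WeierstrassCurve ℚ) [W.IsElliptic] [W.IsGloballyMinimal] (p : ℕ) [Fact p.Prime],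
      W.analyticRank ≤ 1 → N10.CellM W p → MissingLowerBoundAt W p)
    (hGZK : rank_eq_analyticRank_of_analyticRank_le_one) :
    ∀ (W : WeierstrassCurve ℚ) [W.IsElliptic] [W.IsGloballyMinimal],
      (∀ n : ℕ, W.HasSurjectiveModNGaloisRep (3 ^ n : ℕ)) →
      Finite W.sha →
      ∀ {N : ℕ} [NeZero N] (f : CuspForm (Gamma0 N) 2), IsNewformOf W f →
      (∀ r : ℚ, ratPlusSymbol f r ≠ 0 → 0 ≤ padicValRat 3 (ratPlusSymbol f r)) →
      kuriharaVanishingOrder W 3 f = 0 →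
      (haveI : Fact (Nat.Prime 3) := ⟨Nat.prime_three⟩; N10.CellM W 3) →
      (∃ u : ℚ, ‖(u : ℚ_[3])‖ = 1 ∧ W.realPeriodRat = u * plusPeriod f) →
      ¬ 3 ∣ W.tamagawaProduct →
        ∃ d : ℕ, kuriharaPartialDeepInfty W 3 f = d ∧
          kuriharaPartial W 3 f 0 ≤
            ((padicValNat 3 (Nat.card (AddCommGroup.primaryComponent W.sha 3)) + d : ℕ) : ℕ∞) := by
  intro W _ _ htower hfin N _ f hf hint hord hcell hper htam
  haveI : Fact (Nat.Prime 3) := ⟨Nat.prime_three⟩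
  refine deepLowerAtThree_row_cellM_of_multLower_of_tamagawa_le_deepInfty hMult hGZK W htower hfin f hf
    hint hord hcell hper ?_
  rw [padicValNat.eq_zero_of_not_dvd htam, Nat.cast_zero]
  exact zero_le

/-! ### §5 From the BODY of K1's crux `GordTwoRankZeroOffCaseOne` (item 19357) / its odd-parity half
`GordTwoRankZeroOffCaseOneOdd` (item 19245): the (G-ord, `e = 2`)@3 rows -/

/-- **A tower row has no Case-1 member**: `HasCaseOneMember W p` asks for an isogenous `W′` on
X3♯(G-ord), in particular with `E′[p]` REDUCIBLE; but reducibility of `E[p]` is an isogeny invariant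
(`not_hasIrreducibleModPGaloisRep_of_isIsogenous`), so it contradicts `E[p]` irreducible.
[cite: GreenbergVatsal2000, §2 p. 28] [cite: SilvermanAEC2009, Thm. III.6.1(a)] -/
theorem not_hasCaseOneMember_of_irr (W : WeierstrassCurve ℚ) [W.IsElliptic] (p : ℕ) [Fact p.Prime]
    (hirr : W.HasIrreducibleModPGaloisRep p) : ¬ HasCaseOneMember W p := by
  rintro ⟨W', _, _, hiso, hX3, -, -⟩
  exact not_hasIrreducibleModPGaloisRep_of_isIsogenous (p := p) hiso.symm_of_isElliptic hX3.1.1 hirr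

/-- **K1's crux `GordTwoRankZeroOffCaseOne` (item 19357, stated by shape) ∧ GZK ⟹ crux 19075 on the
(G-ord, `e = 2`)@3 tower rows, modulo Tamagawa divisibility.** The first hypothesis is, token for token,
the body of `Theses.AdditiveBranchIMC.GordTwoRankZeroOffCaseOne`; the off-Case-1 clause is automatic on
a tower row (`not_hasCaseOneMember_of_irr`). Row: crux binders + `N10.CellGordTwo W 3` + period
transfer + `v₃(∏ c_ℓ) ≤ ∂^{(∞)}_{deep}(δ̃)`. [cite: Delbourgo1998, Main Conjecture (p. 151)]
[cite: Kim2022StructureSelmer, Conj. 1.10 (PDF p. 8)] -/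
theorem deepLowerAtThree_row_cellGordTwo_of_gordTwoOffCaseOne_of_tamagawa_le_deepInfty
    (hGord : ∀ (W : WeierstrassCurve ℚ) [W.IsElliptic] [W.IsGloballyMinimal] (p : ℕ) [Fact p.Prime],
      W.analyticRank = 0 → N10.CellGordTwo W p → ¬ HasCaseOneMember W p → MissingLowerBoundAt W p)
    (hGZK : rank_eq_analyticRank_of_analyticRank_le_one) :
    ∀ (W : WeierstrassCurve ℚ) [W.IsElliptic] [W.IsGloballyMinimal],
      (∀ n : ℕ, W.HasSurjectiveModNGaloisRep (3 ^ n : ℕ)) →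
      Finite W.sha →
      ∀ {N : ℕ} [NeZero N] (f : CuspForm (Gamma0 N) 2), IsNewformOf W f →
      (∀ r : ℚ, ratPlusSymbol f r ≠ 0 → 0 ≤ padicValRat 3 (ratPlusSymbol f r)) →
      kuriharaVanishingOrder W 3 f = 0 →
      (haveI : Fact (Nat.Prime 3) := ⟨Nat.prime_three⟩; N10.CellGordTwo W 3) →
      (∃ u : ℚ, ‖(u : ℚ_[3])‖ = 1 ∧ W.realPeriodRat = u * plusPeriod f) →
      ((padicValNat 3 W.tamagawaProduct : ℕ) : ℕ∞) ≤ kuriharaPartialDeepInfty W 3 f →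
        ∃ d : ℕ, kuriharaPartialDeepInfty W 3 f = d ∧
          kuriharaPartial W 3 f 0 ≤
            ((padicValNat 3 (Nat.card (AddCommGroup.primaryComponent W.sha 3)) + d : ℕ) : ℕ∞) := by
  intro W _ _ htower _ N _ f hf _ hord hcell hper htam
  haveI : Fact (Nat.Prime 3) := ⟨Nat.prime_three⟩
  have hirr : W.HasIrreducibleModPGaloisRep 3 :=
    hasIrreducibleModPGaloisRep_of_hasSurjectiveModNGaloisRep W 3 (by simpa using htower 1)
  have hr0 := analyticRank_eq_zero_of_kuriharaVanishingOrder_eq_zero W f hf hord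
  exact deepLower_conclusion_three_of_missingLowerBoundAt_of_tamagawa_le_deepInfty W f hGZK htower hf
    hord hper (hGord W 3 hr0 hcell (not_hasCaseOneMember_of_irr W 3 hirr)) htam

/-- **… OUTRIGHT when `3 ∤ ∏ c_ℓ`** (parent shape). [cite: Delbourgo1998, Main Conjecture (p. 151)] -/
theorem deepLowerAtThree_row_cellGordTwo_of_gordTwoOffCaseOne_of_not_three_dvd_tamagawa
    (hGord : ∀ (W : WeierstrassCurve ℚ) [W.IsElliptic] [W.IsGloballyMinimal] (p : ℕ) [Fact p.Prime],
      W.analyticRank = 0 → N10.CellGordTwo W p → ¬ HasCaseOneMember W p → MissingLowerBoundAt W p)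
    (hGZK : rank_eq_analyticRank_of_analyticRank_le_one) :
    ∀ (W : WeierstrassCurve ℚ) [W.IsElliptic] [W.IsGloballyMinimal],
      (∀ n : ℕ, W.HasSurjectiveModNGaloisRep (3 ^ n : ℕ)) →
      Finite W.sha →
      ∀ {N : ℕ} [NeZero N] (f : CuspForm (Gamma0 N) 2), IsNewformOf W f →
      (∀ r : ℚ, ratPlusSymbol f r ≠ 0 → 0 ≤ padicValRat 3 (ratPlusSymbol f r)) →
      kuriharaVanishingOrder W 3 f = 0 →
      (haveI : Fact (Nat.Prime 3) := ⟨Nat.prime_three⟩; N10.CellGordTwo W 3) →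
      (∃ u : ℚ, ‖(u : ℚ_[3])‖ = 1 ∧ W.realPeriodRat = u * plusPeriod f) →
      ¬ 3 ∣ W.tamagawaProduct →
        ∃ d : ℕ, kuriharaPartialDeepInfty W 3 f = d ∧
          kuriharaPartial W 3 f 0 ≤
            ((padicValNat 3 (Nat.card (AddCommGroup.primaryComponent W.sha 3)) + d : ℕ) : ℕ∞) := by
  intro W _ _ htower hfin N _ f hf hint hord hcell hper htam
  haveI : Fact (Nat.Prime 3) := ⟨Nat.prime_three⟩
  refine deepLowerAtThree_row_cellGordTwo_of_gordTwoOffCaseOne_of_tamagawa_le_deepInfty hGord hGZK W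
    htower hfin f hf hint hord hcell hper ?_
  rw [padicValNat.eq_zero_of_not_dvd htam, Nat.cast_zero]
  exact zero_le

/-- **The odd-parity half `GordTwoRankZeroOffCaseOneOdd` (item 19245, by shape: extra clause
`p % 4 = 3`, met at `p = 3`) ∧ GZK ⟹ crux 19075 on the (G-ord, `e = 2`)@3 tower rows, modulo Tamagawa
divisibility.** [cite: Delbourgo1998, Main Conjecture (p. 151)] [cite: Kim2022StructureSelmer, Conj. 1.10 (PDF p. 8)] -/
theorem deepLowerAtThree_row_cellGordTwo_of_gordTwoOffCaseOneOdd_of_tamagawa_le_deepInfty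
    (hOdd : ∀ (W : WeierstrassCurve ℚ) [W.IsElliptic] [W.IsGloballyMinimal] (p : ℕ) [Fact p.Prime],
      W.analyticRank = 0 → N10.CellGordTwo W p → ¬ HasCaseOneMember W p → p % 4 = 3 →
        MissingLowerBoundAt W p)
    (hGZK : rank_eq_analyticRank_of_analyticRank_le_one) :
    ∀ (W : WeierstrassCurve ℚ) [W.IsElliptic] [W.IsGloballyMinimal],
      (∀ n : ℕ, W.HasSurjectiveModNGaloisRep (3 ^ n : ℕ)) →
      Finite W.sha →
      ∀ {N : ℕ} [NeZero N] (f : CuspForm (Gamma0 N) 2), IsNewformOf W f →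
      (∀ r : ℚ, ratPlusSymbol f r ≠ 0 → 0 ≤ padicValRat 3 (ratPlusSymbol f r)) →
      kuriharaVanishingOrder W 3 f = 0 →
      (haveI : Fact (Nat.Prime 3) := ⟨Nat.prime_three⟩; N10.CellGordTwo W 3) →
      (∃ u : ℚ, ‖(u : ℚ_[3])‖ = 1 ∧ W.realPeriodRat = u * plusPeriod f) →
      ((padicValNat 3 W.tamagawaProduct : ℕ) : ℕ∞) ≤ kuriharaPartialDeepInfty W 3 f →
        ∃ d : ℕ, kuriharaPartialDeepInfty W 3 f = d ∧
          kuriharaPartial W 3 f 0 ≤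
            ((padicValNat 3 (Nat.card (AddCommGroup.primaryComponent W.sha 3)) + d : ℕ) : ℕ∞) := by
  intro W _ _ htower _ N _ f hf _ hord hcell hper htam
  haveI : Fact (Nat.Prime 3) := ⟨Nat.prime_three⟩
  have hirr : W.HasIrreducibleModPGaloisRep 3 :=
    hasIrreducibleModPGaloisRep_of_hasSurjectiveModNGaloisRep W 3 (by simpa using htower 1)
  have hr0 := analyticRank_eq_zero_of_kuriharaVanishingOrder_eq_zero W f hf hord
  exact deepLower_conclusion_three_of_missingLowerBoundAt_of_tamagawa_le_deepInfty W f hGZK htower hf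
    hord hper (hOdd W 3 hr0 hcell (not_hasCaseOneMember_of_irr W 3 hirr) (by decide)) htam

/-- **… OUTRIGHT when `3 ∤ ∏ c_ℓ`** (odd half, item 19245 by shape). [cite: Delbourgo1998, Main Conjecture (p. 151)] -/
theorem deepLowerAtThree_row_cellGordTwo_of_gordTwoOffCaseOneOdd_of_not_three_dvd_tamagawa
    (hOdd : ∀ (W : WeierstrassCurve ℚ) [W.IsElliptic] [W.IsGloballyMinimal] (p : ℕ) [Fact p.Prime],
      W.analyticRank = 0 → N10.CellGordTwo W p → ¬ HasCaseOneMember W p → p % 4 = 3 →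
        MissingLowerBoundAt W p)
    (hGZK : rank_eq_analyticRank_of_analyticRank_le_one) :
    ∀ (W : WeierstrassCurve ℚ) [W.IsElliptic] [W.IsGloballyMinimal],
      (∀ n : ℕ, W.HasSurjectiveModNGaloisRep (3 ^ n : ℕ)) →
      Finite W.sha →
      ∀ {N : ℕ} [NeZero N] (f : CuspForm (Gamma0 N) 2), IsNewformOf W f →
      (∀ r : ℚ, ratPlusSymbol f r ≠ 0 → 0 ≤ padicValRat 3 (ratPlusSymbol f r)) →
      kuriharaVanishingOrder W 3 f = 0 →
      (haveI : Fact (Nat.Prime 3) := ⟨Nat.prime_three⟩; N10.CellGordTwo W 3) →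
      (∃ u : ℚ, ‖(u : ℚ_[3])‖ = 1 ∧ W.realPeriodRat = u * plusPeriod f) →
      ¬ 3 ∣ W.tamagawaProduct →
        ∃ d : ℕ, kuriharaPartialDeepInfty W 3 f = d ∧
          kuriharaPartial W 3 f 0 ≤
            ((padicValNat 3 (Nat.card (AddCommGroup.primaryComponent W.sha 3)) + d : ℕ) : ℕ∞) := by
  intro W _ _ htower hfin N _ f hf hint hord hcell hper htam
  haveI : Fact (Nat.Prime 3) := ⟨Nat.prime_three⟩
  refine deepLowerAtThree_row_cellGordTwo_of_gordTwoOffCaseOneOdd_of_tamagawa_le_deepInfty hOdd hGZK W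
    htower hfin f hf hint hord hcell hper ?_
  rw [padicValNat.eq_zero_of_not_dvd htam, Nat.cast_zero]
  exact zero_le

end Summit.BirchSwinnertonDyer.BirchSwinnertonDyer.Theorems.KimAtThreeDeepLowerOfAdditiveBranch

end
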